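import Literature.AlgebraicGeometry.Motives.AbelianVarietyConjugate
import Literature.AlgebraicGeometry.Motives.AbelianVarietyQuotientAction
import Literature.AlgebraicGeometry.Motives.AbelianVarietyWeilPairingAlternating
import Literature.AlgebraicGeometry.Motives.CyclesDimensionFunctionField
import HarnessLib

/-!
# The Weil pairing of a conjugate divisor: `ē_N^{X^σ}(P^σ, Q^σ) = σ(ē_N^X(P, Q))`
# (Shimura 1998, §17.2–§18.6; Milne 1986, §16; Lang VII §2)

Layer `Literature/AlgebraicGeometry/Motives`, namespace `Literature.AlgebraicGeometry.Motives.AbelianVariety`.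
KERNEL ONLY: theorems; no definition, no instance, no named fact, no `sorry`.

Let `A` be an abelian variety over a field `L`, `σ : L ≃+* L` a field automorphism, `A^σ = A.conjugate σ`
(`Motives/AbelianVarietyConjugate`: the base change `A ×_{L,σ} L`, with the projection
`π_σ := baseChangeHomFst σ A.X : A^σ → A` on underlying schemes and the group isomorphism
`x ↦ x^σ = conjPoints σ A x : A(L) ≃* A^σ(L)`, `conjPoints_left_comp_fst`: `x^σ ≫ π_σ = Spec σ ≫ x`).
The CONJUGATE of a Cartier divisor `X` on `A` is its pullback `X^σ := π_σ^* X` along `π_σ` (an isomorphism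
of abstract schemes, twisting the scalars by `σ`; Shimura §17.2 «`Y^σ` for an algebro-geometric object `Y`»).
For the level-`N` Weil pairing of the tree (`Motives/AbelianVarietyWeilPairingLevel`,
`ē_N^X(P, Q) = t_P^♯ g_Q / g_Q`) we prove

  **`ē_N^{X^σ}(P^σ, Q^σ) = σ (ē_N^X(P, Q))`**   (`weilPairingLevel_conjugate`).

This is the compatibility of the `e_N`-pairing with automorphisms of the universal domain — Shimura 1998,
§17.2 / proof of Thm 18.6 (p0168: everything «rational over `L`» is transported by `σ`), Lang,
*Abelian Varieties*, VII §2 (the pairing is defined over the field of definition, hence commutes with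
isomorphisms of the universal domain), Milne 1986 §16 (the `ē_m` are Galois-equivariant); the
base-change-twist twin of the tree's `weilPairingLevel_galSmul` (`Motives/AbelianVarietyWeilPairingGalois`,
`σ ∈ Aut(L/K)` acting on `P_L`).

Proof (transport of structure along `π_σ`):
* `isDominant_baseChangeHomFst` — `π_σ` is surjective (base change of `Spec σ`), so divisors pull back;
* `functionFieldMap_baseChangeHomFst_algebraMap` — **`π_σ^♯ c = σ c` on constants** `c ∈ L ⊆ K(A)`
  (`π_σ ≫ (A → Spec L) = pr₂ ≫ Spec σ`);
* `baseChangeHomFst_comp_zsmul` — `π_σ ≫ [n]_A = [n]_{A^σ} ≫ π_σ` (`[n]_{A^σ} = ([n]_A)^σ`);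
* `translation_conjPoints_left_comp_fst` — **`t_{P^σ} ≫ π_σ = π_σ ≫ t_P`** (on `T`-points both are
  «multiply by the constant point `Spec σ ≫ P`», `transl_fst` of `Motives/AbelianVarietyQuotientAction`);
* `weilDiv_conjugate_sameDivisor` — `D_{Q^σ}(X^σ) = π_σ^* D_Q(X)`; `IsTrivializer.baseChangeHomFst` —
  `π_σ^♯ g` trivializes `[N]^* π_σ^* E`;
* hence `ē^{X^σ}(P^σ, Q^σ) = t_{P^σ}^♯ π_σ^♯ g / π_σ^♯ g = π_σ^♯ (t_P^♯ g / g) = π_σ^♯ ē(P, Q) = σ ē(P, Q)`.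

Use (cell `hodgecm-mathlib`, row II-1 `shimura1998_thm18_6` v2, stub S5 `polarisationTransport` in
ℓ-adic form, B-p20 PREP-II1-S5 (W4)): with `t^σ = κ t` on `A[M]` (Shimura p0168 L9) this gives
`ē^{X^σ}(κ t, κ t′) = σ ē^X(t, t′)`.

## References
* [Shimura1998] G. Shimura, *Abelian Varieties with Complex Multiplication and Modular Functions* (1998),
  §17.2, §18.6 proof (p. 130).
* [Lang1983AbelianVarieties] S. Lang, *Abelian Varieties*, Ch. VII §2, Props. 2–3 (PDF pp. 138–139).
* [Milne1986AbelianVarieties] J. S. Milne, *Abelian varieties*, in Cornell–Silverman (1986), §16, p. 131.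
-/

universe u

open CategoryTheory CategoryTheory.Limits AlgebraicGeometry MonoidalCategory CartesianMonoidalCategory

noncomputable section

namespace Literature.AlgebraicGeometry.Motives

open scoped MonObj
open RatFn

namespace AbelianVariety

variable {L : Type u} [Field L] (σ : L ≃+* L) (A : AbelianVariety L)

/-! ### The projection `π_σ : A^σ → A`: dominance, constants, `[n]`, translations -/

/-- **`π_σ : A^σ → A` is dominant** (it is surjective: the base change of `Spec σ : Spec L → Spec L`,
a surjection of one-point spaces; Hartshorne II.3, base change). [cite: GortzWedhorn2020, Section (4.7) and Prop. 4.16] -/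
theorem isDominant_baseChangeHomFst : IsDominant (baseChangeHomFst σ.toRingHom A.X) := by
  haveI : Surjective (baseChangeHomFst σ.toRingHom A.X) :=
    MorphismProperty.pullback_fst _ _ ⟨fun _ ↦ ⟨Classical.arbitrary _, Subsingleton.elim _ _⟩⟩
  exact ⟨(‹Surjective (baseChangeHomFst σ.toRingHom A.X)›).1.denseRange⟩

/-- **`π_σ^♯ c = σ c` on constants**: the field map `π_σ^♯ : K(A) → K(A^σ)` carries the constant
`c ∈ L ⊆ K(A)` (embedded along `A → Spec L`) to the constant `σ c ∈ L ⊆ K(A^σ)` (embedded along the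
structure map `pr₂ : A^σ → Spec L`), because `π_σ ≫ (A → Spec L) = pr₂ ≫ Spec σ`.
[cite: Shimura1998, §17.2 (Y^σ for objects rational over a field)] -/
theorem functionFieldMap_baseChangeHomFst_algebraMap (π : (A.conjugate σ).X.left ⟶ A.X.left)
    (hπ : π = baseChangeHomFst σ.toRingHom A.X) [IsDominant π] (c : L) :
    functionFieldMap π (algebraMap L A.X.left.functionField c) =
      algebraMap L (A.conjugate σ).X.left.functionField (σ c) := by
  rw [algebraMap_stalk_apply, algebraMap_stalk_apply]
  have hcond : π ≫ (A.X.left ↘ Spec (.of L)) =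
      ((A.conjugate σ).X.left ↘ Spec (.of L)) ≫ Spec.map (CommRingCat.ofHom σ.toRingHom) := by
    rw [hπ]
    exact pullback.condition
  rw [functionFieldMap_algebraMap_top (A.X.left ↘ Spec (.of L)) π _ rfl c,
    hcond, Scheme.Hom.comp_appTop, CommRingCat.comp_apply]
  congr 2
  have h := congrArg (fun φ => φ.hom c) (Scheme.ΓSpecIso_inv_naturality (CommRingCat.ofHom σ.toRingHom))
  simp only [CommRingCat.hom_comp, RingHom.coe_comp, Function.comp_apply, CommRingCat.hom_ofHom] at h
  exact h.symm

/-- `([n]_A)^σ = [n]_{A^σ}` (`σ` on homomorphisms is additive). [cite: Milne2005ShimuraVarieties, §11 p. 108 («α ↦ σα»)] -/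
theorem conjugate_zsmul_id (n : ℤ) : Hom.conjugate σ (n • 𝟙 A) = n • 𝟙 (A.conjugate σ) := by
  change A.endConjugate σ (n • (1 : End A)) = n • (1 : End (A.conjugate σ))
  rw [map_zsmul, map_one]

/-- **`π_σ ≫ [n]_A = [n]_{A^σ} ≫ π_σ`** (`[n]_{A^σ}` is the base change of `[n]_A`). [cite: Milne2005ShimuraVarieties, §11 p. 108 («α ↦ σα»)] -/
@[reassoc]
theorem baseChangeHomFst_comp_zsmul (n : ℤ) :
    baseChangeHomFst σ.toRingHom A.X ≫ Hom.toSchemeHom (n • 𝟙 A) =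
      Hom.toSchemeHom (n • 𝟙 (A.conjugate σ)) ≫ baseChangeHomFst σ.toRingHom A.X := by
  have h := Hom.toSchemeHom_baseChangeAlong_comp_fst σ.toRingHom (n • 𝟙 A)
  rw [← conjugate_zsmul_id]
  exact h.symm

/-- **`t_{P^σ} ≫ π_σ = π_σ ≫ t_P`**: the translation of `A^σ` by the conjugate point `P^σ` covers the
translation of `A` by `P` (on `T`-valued points both composites are «multiply the projection by the
constant point `T → Spec L →^{Spec σ ≫ P} A`»; `transl_fst`). [cite: Shimura1998, §18.6 proof (p. 130)] -/
theorem translation_conjPoints_left_comp_fst (P : A.Points L) :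
    ((A.conjugate σ).translation (A.conjPoints σ P)).left ≫ baseChangeHomFst σ.toRingHom A.X =
      baseChangeHomFst σ.toRingHom A.X ≫ (A.translation P).left := by
  have h1 : ((A.conjugate σ).translation (A.conjPoints σ P)).left ≫ baseChangeHomFst σ.toRingHom A.X =
      (A.constPt (AlongHom L σ.toRingHom) (A.twistPoints σ P) *
        A.fstPt (AlongHom L σ.toRingHom)).left :=
    A.transl_fst (AlongHom L σ.toRingHom) (A.twistPoints σ P)
  have h2 : A.constPt (AlongHom L σ.toRingHom) (A.twistPoints σ P) =
      toSpecOver (A.bcOverK (AlongHom L σ.toRingHom)) ≫ P := by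
    apply Over.OverMorphism.ext
    rw [constPt_left, twistPoints_left, Over.comp_left, toSpecOver_left]
    exact (Category.assoc _ _ _).symm
  have h3 : A.constPt (AlongHom L σ.toRingHom) (A.twistPoints σ P) * A.fstPt (AlongHom L σ.toRingHom) =
      A.fstPt (AlongHom L σ.toRingHom) ≫ A.translation P := by
    rw [h2, translation, MonObj.comp_mul, Category.comp_id, ← Category.assoc, comp_toSpecOver_eq']
  rw [h1, h3, Over.comp_left, fstPt_left]
  rfl

/-- `P^σ` is `N`-torsion when `P` is. [cite: Shimura1998, §18.6 Thm. 18.6 (2) p. 127] -/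
theorem conjPoints_mem_torsionPoints {n : ℤ} {P : A.Points L} (hP : P ∈ A.torsionPoints L n) :
    A.conjPoints σ P ∈ (A.conjugate σ).torsionPoints L n :=
  (A.conjPoints_mem_torsionPoints_iff σ n P).2 hP

/-! ### `D_{Q^σ}(X^σ) = π_σ^* D_Q(X)` and transport of trivializers -/

section Dominant

variable (π : (A.conjugate σ).X.left ⟶ A.X.left) (hπ : π = baseChangeHomFst σ.toRingHom A.X) [IsDominant π]

include hπ in
/-- **`D_{Q^σ}(X^σ) = π_σ^*(D_Q(X))` as divisors**: `t_{Q^σ}^* π_σ^* X − π_σ^* X = (t_{Q^σ} ≫ π_σ)^* X − π_σ^*X =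
(π_σ ≫ t_Q)^* X − π_σ^* X = π_σ^*(t_Q^* X − X)` (here `π = π_σ` is typed on `A^σ`). [cite: Shimura1998, §18.6 proof (p. 130)] -/
theorem weilDiv_conjugate_sameDivisor (Θ : CartierDivisor A.X.left) (Q : A.Points L) :
    ((A.conjugate σ).weilDiv (Θ.pullback π) (A.conjPoints σ Q)).SameDivisor ((A.weilDiv Θ Q).pullback π) := by
  have ht : ((A.conjugate σ).translation (A.conjPoints σ Q)).left ≫ π = π ≫ (A.translation Q).left := by
    rw [hπ]
    exact A.translation_conjPoints_left_comp_fst σ Q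
  haveI : IsDominant (((A.conjugate σ).translation (A.conjPoints σ Q)).left ≫ π) := inferInstance
  haveI : IsDominant (π ≫ (A.translation Q).left) := inferInstance
  have h1 : ((Θ.pullback π).pullback ((A.conjugate σ).translation (A.conjPoints σ Q)).left).SameDivisor
      ((Θ.pullback (A.translation Q).left).pullback π) :=
    ((Θ.pullback_pullback_sameDivisor _ _).trans (Θ.pullback_congr_sameDivisor ht)).trans
      (Θ.pullback_pullback_sameDivisor _ _).symm
  have h2 : (-(Θ.pullback π)).SameDivisor ((-Θ).pullback π) := (CartierDivisor.pullback_neg_sameDivisor _ Θ).symm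
  exact (h1.add h2).trans (CartierDivisor.pullback_add_sameDivisor _ _ _).symm

variable {N : ℕ} [IsDominant (Hom.toSchemeHom ((N : ℤ) • 𝟙 A))]
  [IsDominant (Hom.toSchemeHom ((N : ℤ) • 𝟙 (A.conjugate σ)))]

include hπ in
/-- **`π_σ^♯ g` trivializes `[N]_{A^σ}^* π_σ^* E` if `g` trivializes `[N]_A^* E`** (`π_σ` commutes with `[N]`).
[cite: Lang1983AbelianVarieties, Ch. VII §2 Prop. 3] -/
theorem IsTrivializer.baseChangeHomFst {E : CartierDivisor A.X.left} {g : A.X.left.functionField}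
    (hg : A.IsTrivializer (n := N) E g) :
    (A.conjugate σ).IsTrivializer (n := N) (E.pullback π) (functionFieldMap π g) := by
  refine ⟨(map_ne_zero _).2 hg.1, fun i x hi => ?_⟩
  have hcomm : π ≫ Hom.toSchemeHom ((N : ℤ) • 𝟙 A) = Hom.toSchemeHom ((N : ℤ) • 𝟙 (A.conjugate σ)) ≫ π := by
    rw [hπ]
    exact A.baseChangeHomFst_comp_zsmul σ (N : ℤ)
  have hi' : Hom.toSchemeHom ((N : ℤ) • 𝟙 A) (π x) ∈ E.U i := by
    rw [← Scheme.Hom.comp_apply, hcomm, Scheme.Hom.comp_apply]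
    exact hi
  have h1 : IsUnitAt x (functionFieldMap π (functionFieldMap (Hom.toSchemeHom ((N : ℤ) • 𝟙 A)) (E.f i) * g)) :=
    (hg.2 i _ hi').functionFieldMap
  rw [map_mul] at h1
  haveI : IsDominant (π ≫ Hom.toSchemeHom ((N : ℤ) • 𝟙 A)) := inferInstance
  haveI : IsDominant (Hom.toSchemeHom ((N : ℤ) • 𝟙 (A.conjugate σ)) ≫ π) := inferInstance
  have h2 := functionFieldMap_comp (Hom.toSchemeHom ((N : ℤ) • 𝟙 A)) π
  have h3 := functionFieldMap_comp π (Hom.toSchemeHom ((N : ℤ) • 𝟙 (A.conjugate σ)))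
  have h4 : functionFieldMap (π ≫ Hom.toSchemeHom ((N : ℤ) • 𝟙 A)) =
      functionFieldMap (Hom.toSchemeHom ((N : ℤ) • 𝟙 (A.conjugate σ)) ≫ π) :=
    functionFieldMap_congr hcomm
  rw [h2, h3] at h4
  have h5 := congrArg (fun φ => φ (E.f i)) h4
  simp only [RingHom.coe_comp, Function.comp_apply] at h5
  convert h1 using 2
  rw [CartierDivisor.pullback_f]
  exact h5.symm

/-! ### `ē_N^{X^σ}(P^σ, Q^σ) = σ (ē_N^X(P, Q))` -/

include hπ in
/-- **The Weil pairing of the conjugate divisor at conjugate points is the conjugate of the Weil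
pairing**: for a Cartier divisor `X` on `A`, `σ ∈ Aut(L)` and `P, Q ∈ A[N](L)`,
`ē_N^{X^σ}(P^σ, Q^σ) = σ (ē_N^X(P, Q))`, where `X^σ = π_σ^* X` on `A^σ` and `P^σ = conjPoints σ A P`
(Shimura 1998 §17.2/§18.6: `(Y^σ)` for every object `Y` rational over `L`; Lang VII §2: `e_N` is defined
over the field of definition; Milne 1986 §16).  Proof: `π_σ^♯ g_Q` trivializes `[N]^* D_{Q^σ}(X^σ)` and
`t_{P^σ}^♯ π_σ^♯ g / π_σ^♯ g = π_σ^♯(t_P^♯ g / g) = π_σ^♯ ē(P, Q) = σ ē(P, Q)`.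
[cite: Shimura1998, §18.6 proof (p. 130)] [cite: Milne1986AbelianVarieties, §16 (p. 131, the pairings ē_m)] -/
theorem weilPairingLevel_conjugate (Θ : CartierDivisor A.X.left) (P Q : A.torsionPoints L N) :
    (A.conjugate σ).weilPairingLevel (Θ.pullback π)
        ⟨A.conjPoints σ P.1, A.conjPoints_mem_torsionPoints σ P.2⟩
        ⟨A.conjPoints σ Q.1, A.conjPoints_mem_torsionPoints σ Q.2⟩ =
      σ (A.weilPairingLevel Θ P Q) := by
  have hg : A.IsTrivializer (n := N) (A.weilDiv Θ Q.1) (A.weilFn Θ Q) := A.isTrivializer_weilFn Θ Q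
  -- the transported trivializer of `[N]^* D_{Q^σ}(X^σ)`
  have hg' : (A.conjugate σ).IsTrivializer (n := N)
      ((A.conjugate σ).weilDiv (Θ.pullback π) (A.conjPoints σ Q.1)) (functionFieldMap π (A.weilFn Θ Q)) :=
    (IsTrivializer.baseChangeHomFst σ A π hπ hg).of_sameDivisor (A.weilDiv_conjugate_sameDivisor σ π hπ Θ Q.1).symm
  rw [weilPairingLevel_eq_kummerConst (Q := ⟨A.conjPoints σ Q.1, A.conjPoints_mem_torsionPoints σ Q.2⟩) hg'
    ⟨A.conjPoints σ P.1, A.conjPoints_mem_torsionPoints σ P.2⟩]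
  apply (algebraMap L (A.conjugate σ).X.left.functionField).injective
  rw [algebraMap_kummerConst]
  -- `t_{P^σ}^♯ ∘ π_σ^♯ = π_σ^♯ ∘ t_P^♯`
  have ht : ((A.conjugate σ).translation (A.conjPoints σ P.1)).left ≫ π = π ≫ (A.translation P.1).left := by
    rw [hπ]
    exact A.translation_conjPoints_left_comp_fst σ P.1
  haveI : IsDominant (((A.conjugate σ).translation (A.conjPoints σ P.1)).left ≫ π) := inferInstance
  haveI : IsDominant (π ≫ (A.translation P.1).left) := inferInstance
  have hFF : (functionFieldMap ((A.conjugate σ).translation (A.conjPoints σ P.1)).left).comp (functionFieldMap π) =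
      (functionFieldMap π).comp (functionFieldMap (A.translation P.1).left) := by
    have h := functionFieldMap_congr ht
    rw [functionFieldMap_comp, functionFieldMap_comp] at h
    exact h
  change functionFieldMap ((A.conjugate σ).translation (A.conjPoints σ P.1)).left (functionFieldMap π (A.weilFn Θ Q)) /
      functionFieldMap π (A.weilFn Θ Q) = _
  rw [← RingHom.comp_apply (functionFieldMap ((A.conjugate σ).translation (A.conjPoints σ P.1)).left), hFF,
    RingHom.comp_apply, ← map_div₀]
  change functionFieldMap π (A.translFF P.1 (A.weilFn Θ Q) / A.weilFn Θ Q) = _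
  rw [← algebraMap_kummerConst hg P, A.functionFieldMap_baseChangeHomFst_algebraMap σ π hπ]
  rfl

end Dominant

end AbelianVariety

end Literature.AlgebraicGeometry.Motives

end
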